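/-
Copyright: seat `ym-line-cbag-p2` (prover-ym-line-cbag-p2-g0-0), route `ColdBoxAllGroups`, crux `BulkAllGroups`
(stmt-QuantumFields-22255).
-/
import Summits.QuantumFields.YangMills.Theorems.WeakCouplingRates
import Summits.QuantumFields.YangMills.Theorems.WeakCouplingRatesDefs
import Summits.QuantumFields.YangMills.Theorems.EquipartitionCriticalityFreeEnergyLogCoefficientDefs

/-!
# Route `ColdBoxAllGroups` — posited objects of the BULK split for EVERY compact gauge group (line `dlr-chessboard-G`
# of crux `BulkAllGroups`, stmt-QuantumFields-22255): the DLR–chessboard predicates `PlaquetteLargeFieldRarityG`,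
# `CrudeGoodG`, `GoodBoundaryCovStableG`, `GoodBoundaryMeanSmoothG`, `BoxPolyFloorG`, `DlrAssemblyG` and the box kernel `boxKernelG`

The crux `Summit.QuantumFields.YangMills.Theses.ColdBoxAllGroups.BulkAllGroups` (for every compact simple `G`, every faithful
unitary lattice representation `r` and every ceiling `θ₀ > 0` there are exponents `0 < A < θ ≤ θ₀` with
`BulkDominatesBox r.ρ A θ` — eventually in the torus size `L`, the torus-state covariance of the `(1,2)`-plaquette cost
`N − Re tr ρ(U_p)` and its time-translate by `⌈β^A⌉` is `≥ η ×` the same covariance in the cold-wall Wilson box of side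
`2⌈β^θ⌉+1`) is the all-`G` re-typing of the PROVED `SU(2)` crux `BulkDominatesColdBoxW` (`BulkDominatesColdBoxW_proof`, route
`WeakCouplingRates`).  Its `SU(2)` line `dlr-chessboard` posited six predicates typed for `SU(2)` / fundamental action
(`Theorems/WeakCouplingRatesBulkDominatesColdBoxWDefs.lean`); this file types the SAME predicates for a general compact
group `G` with a unitary matrix representation `ρ : G →* M_N(ℂ)` (explicit parameter, exactly as the leaf currencies
`boxPlaqCov ρ`, `torusPlaqCov ρ`, `BulkDominatesBox ρ` are typed), so that the G-port of every stub of that line can be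
landed BY NAME + SIGNATURE against tree objects:

* `PlaquetteLargeFieldRarityG ρ δ` (input L2-G) — volume-uniform large-field rarity of ONE plaquette of the torus states:
  `∃ β₀, ∀ β ≥ β₀, ∀ᶠ L, ∀ x, ∀ i < j, wilsonExpectation_{(L+1)⁴} 𝟙{β^{2δ−1} ≤ plaqCostAt ρ x i j} ≤ exp(−β^δ)`
  (reflection positivity + the Fröhlich–Israel–Lieb–Simon chessboard estimate, host tree
  `WilsonPlaquetteTail.measureReal_plaquette_mem_le`, generic in `G`; Haar small balls `haar_ball_ge_of_unitaryRep`);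
* `boxKernelG ρ β H ω` — the DLR box kernel `ymSpecification ρ β (boxEdges 4 (2H+1)) ω` of the cube `[0,2H]⁴` (`ω ≡ 1` is
  the leaf's `boxState ρ β H`);
* `CrudeGoodG ρ β δ H ω` — «crude-good» boundary datum: every plaquette of `ω` based in the corona range `[−1, 2H+1]⁴` has cost
  `≤ β^{2δ−1}` (`≤ 6(2H+3)⁴` plaquettes, independently of the torus size);
* `GoodBoundaryCovStableG ρ A θ δ η₁` (input L1a-G, load-bearing) — for crude-good `ω` the box-kernel covariance of the two
  central plaquette costs at separation `⌈β^A⌉` is `≥ η₁ ×` the cold-wall one (`boxPlaqCov ρ`), `H = ⌈β^θ⌉`;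
* `GoodBoundaryMeanSmoothG ρ A θ δ` (input L1b-G) — for crude-good `ω` the two conditional means differ by
  `≤ K β^{2δ−1} ⌈β^A⌉/⌈β^θ⌉`;
* `BoxPolyFloorG ρ A θ K` (input L4-G) — the cold-wall covariance is eventually `≥ β^{−K}` (a consequence of the sibling crux
  BOX_G `BoxFloorAllGroups` + the G-free FLOOR `curvatureCorrPowerFloor_proof`);
* `DlrAssemblyG` (input L3-G) — the DLR law of total covariance: for every compact `G` and every `LatticeRep G`, on the window
  `K + 4δ + 2A < 2 + 2θ` the four inputs give `BulkDominatesBox r.ρ A θ` (probability + DLR plumbing, no analysis, no Lie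
  theory: the `SU(2)` proof `stub_dlrAssembly` is generic in the group but typed for `SU(2)`).

Design notes.  (1) `d = 4`; the representation `ρ` is an explicit parameter and the measurable structure on `G` an instance
parameter (the crux instantiates `borel G`).  (2) The predicates are the LINE's posits, not claims: typing them asserts
nothing.  L2-G and L3-G hold for every compact `G` and every continuous unitary (faithful, for second countability) `ρ`;
L1a-G/L1b-G/L4-G are where the Lie structure (`IsCompactSimpleLieGroup`, the exponential chart `expChart ρ`) enters.
(3) Namespace `Summit.QuantumFields.YangMills.Theorems.ColdBoxAllGroups`.  No theorem of substance here: two `rfl`/one-line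
lemmas only.  NOT a claim about the mass gap: the crux is a rung-level (R2xi-G `XiPow`, RECORD label) finite-volume comparison,
and the Yang–Mills mass gap is NOT proved by any of this.

References: H.-O. Georgii, *Gibbs Measures and Phase Transitions* (2011) Thm. 4.17 (DLR consistency); J. Fröhlich, R. Israel,
E. H. Lieb, B. Simon, CMP 62 (1978) Thm. 4.1 (chessboard estimate); E. Seiler, LNP 159 (1982) Ch. 2; R. Durrett (2019) §4.1
(law of total covariance).
-/

set_option autoImplicit false

noncomputable section

open MeasureTheory Filter Topology
open Literature.MathematicalPhysics Literature.MathematicalPhysics.QuantumFieldTheory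
open Literature.MathematicalPhysics.QuantumLattice
open Summit.QuantumFields.YangMills.Theorems.WeakCouplingRates

namespace Summit.QuantumFields.YangMills.Theorems.ColdBoxAllGroups

section Predicates

variable {N : ℕ} {G : Type*} [Group G] [TopologicalSpace G] [IsTopologicalGroup G] [CompactSpace G]
  [MeasurableSpace G] [BorelSpace G]

variable (ρ : G →* Matrix (Fin N) (Fin N) ℂ)

/-- **L2-G (first lemma) — volume-uniform large-field rarity of one plaquette**, any compact `G`, `d = 4`: for `β ≥ β₀` and
all large tori, `μ_{L+1,β}(c_p ≥ β^{2δ-1}) ≤ exp(−β^δ)` for EVERY plaquette `p = (x; i<j)` (cost `c_p = N − Re tr ρ(U_p)`; all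
sites and planes, as the union bound of L3-G needs).  Route to it: reflection positivity ⇒ chessboard estimate ⇒
`μ(c_p ≥ t) ≤ 2e^{−β t}·e^{O(1)}/Haar(ball β^{-1/2})⁴` (host tree `WilsonPlaquetteTail.measureReal_plaquette_mem_le` on even sides, the
odd-torus doubling `SoloBlind.wilsonExpectation_exp_plaquetteCost_le` on odd sides), `Haar(ball r) ≥ c r^{dim}`
(`haar_ball_ge_of_unitaryRep`).  The `G`-typed form of `WeakCouplingRates.PlaquetteLargeFieldRarity`.  A predicate posited
by the line, not a literature fact. -/
def PlaquetteLargeFieldRarityG (δ : ℝ) : Prop :=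
  ∃ β₀ : ℝ, ∀ β : ℝ, β₀ ≤ β → ∀ᶠ L : ℕ in atTop, ∀ (x : Literature.Probability.LatticeModels.Site 4) (i j : Fin 4), i < j →
    wilsonExpectation (L := L + 1) ρ β
        (toTorusObservable (L + 1) fun U : LGConfig 4 G =>
          if β ^ (2 * δ - 1) ≤ plaqCostAt ρ x i j U then (1 : ℝ) else 0)
      ≤ Real.exp (-(β ^ δ))

/-- Shorthand: the DLR box kernel of the cube `[0, 2H]⁴` with boundary datum `ω` (the tree's `ymSpecification`; `ω ≡ 1` is
`boxState ρ β H`); route-posited plumbing object, the `G`-typed form of `WeakCouplingRates.boxKernel`. -/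
def boxKernelG (β : ℝ) (H : ℕ) (ω : LGConfig 4 G) : Measure (LGConfig 4 G) :=
  ymSpecification (d := 4) ρ β (AxialGauge.boxEdges 4 (2 * H + 1)) ω

/-- The box kernel with the flat datum is the leaf's cold-wall box state `boxState`. [folklore] -/
theorem boxKernelG_one (β : ℝ) (H : ℕ) : boxKernelG ρ β H (fun _ => 1) = boxState ρ β H := rfl

/-- «crude-good» boundary datum at scale `β^{2δ-1}` FOR THE BOX `[0, 2H]⁴`, any `G`: every plaquette of `ω` based in the corona
range `[-1, 2H+1]⁴` (this contains every plaquette the kernel `ymSpecification … (boxEdges 4 (2H+1)) ω` depends on) has cost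
`N − Re tr ρ(ω_p) ≤ β^{2δ-1}`.  The range has `≤ 6 (2H+3)⁴` plaquettes INDEPENDENTLY of the torus size (this is what makes the
union bound of L3-G uniform in `L`).  The `G`-typed form of `WeakCouplingRates.CrudeGood`; a predicate posited by the line. -/
def CrudeGoodG (β δ : ℝ) (H : ℕ) (ω : LGConfig 4 G) : Prop :=
  ∀ (x : Literature.Probability.LatticeModels.Site 4), (∀ k : Fin 4, (-1 : ℤ) ≤ x k ∧ x k ≤ 2 * (H : ℤ) + 1) →
    ∀ (i j : Fin 4), i < j → plaqCostAt ρ x i j ω ≤ β ^ (2 * δ - 1)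

omit [TopologicalSpace G] [IsTopologicalGroup G] [CompactSpace G] [MeasurableSpace G] [BorelSpace G] in
/-- The flat datum is crude-good whenever the threshold is non-negative and `ρ 1` has real trace `N` (every plaquette cost of
`ω ≡ 1` is `N − Re tr ρ(1) = 0` for a genuine representation, `ρ 1 = 1`). [folklore] -/
theorem crudeGoodG_one {β δ : ℝ} (hβ : 0 ≤ β) (H : ℕ) : CrudeGoodG ρ β δ H (fun _ => 1) := by
  intro x _ i j _
  have h0 : plaqCostAt ρ x i j (fun _ : QuantumLattice.ZdEdge 4 => (1 : G)) = 0 := by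
    simp only [plaqCostAt, plaquetteObs, plaquetteHolonomyZd, mul_one, inv_one, map_one, Matrix.trace_one,
      Fintype.card_fin, Complex.natCast_re, sub_self]
  rw [h0]
  exact Real.rpow_nonneg hβ _

/-- **L1a-G (finite volume, uniform over small boundary data) — deep covariances of the DLR box kernel are stable**, any `G`:
for boundary data `ω` all of whose plaquettes in the corona range of the box have cost `≤ β^{2δ-1}` (`CrudeGoodG`), the box kernel
`γ_Λ(·|ω) = boxKernelG ρ β H ω` has central plaquette-cost covariance at separation `T = ⌈β^A⌉` at least `η₁ ×` the cold-wall one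
(`boxPlaqCov ρ β H T`, `ω ≡ 1`), for `H = ⌈β^θ⌉`.  Content for a compact simple Lie group: the one-scale expansion of the kernel in
the exponential chart `expChart ρ` around the forest-gauged small datum (Gaussian value `(dim G/2)·C_D² + 2β⟨F̄_p,F̄_q⟩C_D`, the
`SU(2)` instance is `goodBoundaryCovStable_of_kernelCovExpansion`).  The `G`-typed form of `WeakCouplingRates.GoodBoundaryCovStable`.
A POSIT of the line (open stub), not a claim and not a literature fact. -/
def GoodBoundaryCovStableG (A θ δ η₁ : ℝ) : Prop :=
  ∃ β₀ : ℝ, ∀ β : ℝ, β₀ ≤ β → ∀ ω : LGConfig 4 G, CrudeGoodG ρ β δ ⌈β ^ θ⌉₊ ω →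
    η₁ * boxPlaqCov ρ β ⌈β ^ θ⌉₊ ⌈β ^ A⌉₊ ≤
      (∫ U, plaqCostAt ρ (boxCentre ⌈β ^ θ⌉₊) 1 2 U *
            plaqCostAt ρ (boxCentre ⌈β ^ θ⌉₊ + Pi.single 0 (⌈β ^ A⌉₊ : ℤ)) 1 2 U ∂(boxKernelG ρ β ⌈β ^ θ⌉₊ ω)) -
        (∫ U, plaqCostAt ρ (boxCentre ⌈β ^ θ⌉₊) 1 2 U ∂(boxKernelG ρ β ⌈β ^ θ⌉₊ ω)) *
          (∫ U, plaqCostAt ρ (boxCentre ⌈β ^ θ⌉₊ + Pi.single 0 (⌈β ^ A⌉₊ : ℤ)) 1 2 U ∂(boxKernelG ρ β ⌈β ^ θ⌉₊ ω))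

/-- **L1b-G — deep conditional MEANS are position-smooth**, any `G`: for every crude-good `ω` (this includes the cold wall `ω ≡ 1`)
the conditional mean of the plaquette cost changes by at most `K β^{2δ-1} T/H` between the centre plaquette and its translate by
`T = ⌈β^A⌉` (`H = ⌈β^θ⌉`): the background extending `ω` has curvature `≤ β^{δ-1/2}` and gradient `≲ β^{δ-1/2}/H` at depth `H`
(elliptic interior regularity of the harmonic background; the `SU(2)` instance is `goodBoundaryMeanSmooth_of_kernelMeanExpansion`).
The `G`-typed form of `WeakCouplingRates.GoodBoundaryMeanSmooth`.  A POSIT of the line (open stub), not a claim and not a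
literature fact. -/
def GoodBoundaryMeanSmoothG (A θ δ : ℝ) : Prop :=
  ∃ K : ℝ, ∃ β₀ : ℝ, ∀ β : ℝ, β₀ ≤ β → ∀ ω : LGConfig 4 G, CrudeGoodG ρ β δ ⌈β ^ θ⌉₊ ω →
    |(∫ U, plaqCostAt ρ (boxCentre ⌈β ^ θ⌉₊ + Pi.single 0 (⌈β ^ A⌉₊ : ℤ)) 1 2 U ∂(boxKernelG ρ β ⌈β ^ θ⌉₊ ω)) -
        (∫ U, plaqCostAt ρ (boxCentre ⌈β ^ θ⌉₊) 1 2 U ∂(boxKernelG ρ β ⌈β ^ θ⌉₊ ω))|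
      ≤ K * β ^ (2 * δ - 1) * (⌈β ^ A⌉₊ : ℝ) / (⌈β ^ θ⌉₊ : ℝ)

/-- **L4-G — polynomial box floor** (much weaker than BOX_G + FLOOR, which give exponent `2 + 8A`): the cold-wall covariance is
eventually `≥ β^{-K}`.  The `G`-typed form of `WeakCouplingRates.BoxPolyFloor`; a predicate posited by the line (= the route's sibling
crux `BoxFloorAllGroups` + the G-free FLOOR `curvatureCorrPowerFloor_proof` + arithmetic along the family). -/
def BoxPolyFloorG (A θ K : ℝ) : Prop :=
  ∃ β₀ : ℝ, ∀ β : ℝ, β₀ ≤ β → β ^ (-K) ≤ boxPlaqCov ρ β ⌈β ^ θ⌉₊ ⌈β ^ A⌉₊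

end Predicates

/-- **L3-G — the DLR assembly for every compact gauge group** (law of total covariance for the torus state conditioned on the
complement of the box, `Cov(h,k) ≥ −¼ ∫(k−h)²` for the conditional-mean term, good/bad split of the boundary datum
(`CrudeGoodG`) with `|c| ≤ 2N`, union bound over the `≤ 6(2H+3)⁴` corona plaquettes (uniform in `L`) using L2-G, translation
invariance of the torus state, and the DLR consistency of the torus Wilson measure with the box kernel — torus side
`L+1 > 2(2H+T+2)` so that box + corona do not wrap): for every compact `G` with its Borel structure and every faithful continuous
unitary `r : LatticeRep G`, when `K + 4δ + 2A < 2 + 2θ` the four inputs give `BulkDominatesBox r.ρ A θ` (with `η = η₁/2`).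
Probability + DLR plumbing, no analysis and no Lie theory (the `SU(2)` instance is `stub_dlrAssembly`).  The `G`-typed form of
`WeakCouplingRates.DlrAssembly`; a parameterless `Prop` naming the line's composition step, to be PROVED in `Theorems/`
(never a named fact). -/
def DlrAssemblyG : Prop :=
  ∀ (G : Type) [Group G] [TopologicalSpace G] [IsTopologicalGroup G] [CompactSpace G] [MeasurableSpace G] [BorelSpace G]
    (r : LatticeRep G) (A θ δ η₁ K : ℝ), 0 < A → 0 < δ → 0 < η₁ → K + 4 * δ + 2 * A < 2 + 2 * θ →
    GoodBoundaryCovStableG r.ρ A θ δ η₁ → GoodBoundaryMeanSmoothG r.ρ A θ δ → PlaquetteLargeFieldRarityG r.ρ δ →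
      BoxPolyFloorG r.ρ A θ K → BulkDominatesBox r.ρ A θ



/-! ## Appended 2026-08-27 (lead seat p2, skeleton v3): the INTERFACES of stubs L1a-G / L1b-G — the N2-G one-scale expansions

As in the `SU(2)` line (census v3 of crux `BulkDominatesColdBoxW`, `Theorems/WeakCouplingRatesBulkDominatesColdBoxWDefs.lean`, appended
2026-08-26): the box kernel with a crude-good datum linearises around the FLAT configuration in the exponential chart `expChart ρ`
(`D = dimE ρ` real coordinates per link, cost `N − Re tr ρ(ψ a) = |a|²/2 + O(|a|⁴)` — the route's support item `ExpChartPackage2`), the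
datum entering only as the mean shift of the temporal-gauge Dirichlet Gaussian `boxDirichlet H` (D1', `Theorems/WeakCouplingRatesDefs.lean`):
`D` independent lattice-Maxwell copies with one-colour Dirichlet data `ϑ c`, `c < D`, background circulations
`F̄_c = sCirc (glue (ϑ c) (mean (ϑ c)))`.  L1b-G then follows from `KernelMeanExpansionG` and the LANDED G-free flatness N1′
(`dirKernelDiagFlat`); L1a-G from `KernelCovExpansionG`, `FlatCovExpansionG` and the LANDED G-free kernel size N1
(`stub_dirKernelTwoPoint`) — the kernel-checked reductions are the G-ports of `…MeanSmoothOfExpansion` / `…CovStableOfExpansion`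
(constants `3/2 ↦ D/2`, `Fin 3 ↦ Fin D`; `D ≥ 1` by `dimE_pos_of_isCompactSimpleLieGroup`).  The total Maxwell energy of the data is
bounded by `CE·(2H+3)⁴·β^{2δ−1}` with a constant `CE` left existential (the `SU(2)` value `16` is chart-specific; the reductions only
use that it is a constant).  POSITS of the line (open sub-stubs), typed here so that they can be proved BY NAME; not claims, not
literature facts. -/

section Interfaces

variable {N : ℕ} {G : Type*} [Group G] [TopologicalSpace G] [IsTopologicalGroup G] [CompactSpace G]
  [MeasurableSpace G] [BorelSpace G]

variable (ρ : G →* Matrix (Fin N) (Fin N) ℂ)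

open Summit.QuantumFields.YangMills.Theorems.FreeEnergyLogCoefficient (dimE)

/-- **Interface N2-G (mean form) — the one-scale expansion of deep kernel MEANS, uniformly over crude-good data**, any `G`
(`D = dimE ρ`).  For `β ≥ β₀` and every crude-good datum `ω` (scale `β^{2δ-1}`, box `H = ⌈β^θ⌉`) there are one-colour Dirichlet data
`ϑ c` (`c < D`) and free competitors `s c` of total Maxwell energy `Σ_c M_{ϑ c}(s c) ≤ CE(2H+3)⁴β^{2δ-1}`, such that at EVERY base point `x`
within `H/8` of the centre (sup norm) the kernel mean of the `(1,2)`-plaquette cost is the Gaussian value up to `β^{-θ}`: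
`|β·E_ω[c_{(x;1,2)}] − (D/2)·V_D(x;1,2) − β·Σ_c F̄_c(x;1,2)²| ≤ β^{-θ}`, `V_D = boxDirProjKernel H q q`,
`F̄_c = sCirc (glue (ϑ c) (mean (ϑ c)))`.  The `G`-typed form of `WeakCouplingRates.KernelMeanExpansion` (`SU(2)`: `D = 3`, `CE = 16`).
A POSIT of the line (open), not a claim and not a literature fact. -/
def KernelMeanExpansionG (θ δ : ℝ) : Prop :=
  ∃ CE : ℝ, ∃ β₀ : ℝ, ∀ β : ℝ, β₀ ≤ β → ∀ ω : LGConfig 4 G, CrudeGoodG ρ β δ ⌈β ^ θ⌉₊ ω →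
    ∃ ϑ : Fin (dimE ρ) → (Literature.MathematicalPhysics.QuantumLattice.ZdEdge 4 → ℝ), ∃ s : Fin (dimE ρ) → (DirFree ⌈β ^ θ⌉₊ → ℝ),
      (∑ c, LatticeMaxwell.formM (fun e => e ∉ dirFreeEdges ⌈β ^ θ⌉₊) dirCorner (2 * ⌈β ^ θ⌉₊ + 3) (ϑ c) (s c) ≤
          CE * (2 * (⌈β ^ θ⌉₊ : ℝ) + 3) ^ 4 * β ^ (2 * δ - 1)) ∧
      ∀ x : Literature.Probability.LatticeModels.Site 4,
        (∀ m : Fin 4, 8 * |x m - (⌈β ^ θ⌉₊ : ℤ)| ≤ (⌈β ^ θ⌉₊ : ℤ)) →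
          |β * (∫ U, plaqCostAt ρ x 1 2 U ∂(boxKernelG ρ β ⌈β ^ θ⌉₊ ω)) -
              (dimE ρ : ℝ) / 2 * boxDirProjKernel ⌈β ^ θ⌉₊ (x, 1, 2) (x, 1, 2) -
              β * ∑ c, LatticeMaxwell.sCirc (LatticeMaxwell.glue (pin := fun e => e ∉ dirFreeEdges ⌈β ^ θ⌉₊) dirCorner (2 * ⌈β ^ θ⌉₊ + 3)
                (ϑ c) (LatticeMaxwell.mean (fun e => e ∉ dirFreeEdges ⌈β ^ θ⌉₊) dirCorner (2 * ⌈β ^ θ⌉₊ + 3) (ϑ c)))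
                  (x, 1, 2) ^ 2| ≤ β ^ (-θ)

/-- **Interface N2-G (covariance form) — the one-scale expansion of the deep kernel COVARIANCE, uniformly over crude-good data**, any
`G` (`D = dimE ρ`).  For `β ≥ β₀` and every crude-good `ω` there are one-colour Dirichlet data `ϑ c` and competitors `s c` of total energy
`≤ CE(2H+3)⁴β^{2δ-1}` with `|β²·Cov_ω(c_p, c_q) − (D/2)·C_D(p,q)² − 2β·(Σ_c F̄_c(p)F̄_c(q))·C_D(p,q)| ≤ β^{-θ/2}`, `p = (boxCentre H; 1,2)`,
`q = p + ⌈β^A⌉e₀`, `C_D = boxDirProjKernel H p q` (Wick: `Cov(½t_p², ½t_q²) = ½C_D²` per colour; the cross term `2β F̄_pF̄_q Cov(t_p,t_q)`; odd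
moments vanish).  The `G`-typed form of `WeakCouplingRates.KernelCovExpansion`.  A POSIT of the line (open), not a claim and not a
literature fact. -/
def KernelCovExpansionG (A θ δ : ℝ) : Prop :=
  ∃ CE : ℝ, ∃ β₀ : ℝ, ∀ β : ℝ, β₀ ≤ β → ∀ ω : LGConfig 4 G, CrudeGoodG ρ β δ ⌈β ^ θ⌉₊ ω →
    ∃ ϑ : Fin (dimE ρ) → (Literature.MathematicalPhysics.QuantumLattice.ZdEdge 4 → ℝ), ∃ s : Fin (dimE ρ) → (DirFree ⌈β ^ θ⌉₊ → ℝ),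
      (∑ c, LatticeMaxwell.formM (fun e => e ∉ dirFreeEdges ⌈β ^ θ⌉₊) dirCorner (2 * ⌈β ^ θ⌉₊ + 3) (ϑ c) (s c) ≤
          CE * (2 * (⌈β ^ θ⌉₊ : ℝ) + 3) ^ 4 * β ^ (2 * δ - 1)) ∧
      |β ^ 2 * ((∫ U, plaqCostAt ρ (boxCentre ⌈β ^ θ⌉₊) 1 2 U *
              plaqCostAt ρ (boxCentre ⌈β ^ θ⌉₊ + Pi.single 0 (⌈β ^ A⌉₊ : ℤ)) 1 2 U ∂(boxKernelG ρ β ⌈β ^ θ⌉₊ ω)) -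
            (∫ U, plaqCostAt ρ (boxCentre ⌈β ^ θ⌉₊) 1 2 U ∂(boxKernelG ρ β ⌈β ^ θ⌉₊ ω)) *
              (∫ U, plaqCostAt ρ (boxCentre ⌈β ^ θ⌉₊ + Pi.single 0 (⌈β ^ A⌉₊ : ℤ)) 1 2 U ∂(boxKernelG ρ β ⌈β ^ θ⌉₊ ω))) -
          (dimE ρ : ℝ) / 2 * boxDirProjKernel ⌈β ^ θ⌉₊ (boxCentre ⌈β ^ θ⌉₊, 1, 2) (boxCentre ⌈β ^ θ⌉₊ + Pi.single 0 (⌈β ^ A⌉₊ : ℤ), 1, 2) ^ 2 -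
          2 * β * (∑ c,
              LatticeMaxwell.sCirc (LatticeMaxwell.glue (pin := fun e => e ∉ dirFreeEdges ⌈β ^ θ⌉₊) dirCorner (2 * ⌈β ^ θ⌉₊ + 3)
                  (ϑ c) (LatticeMaxwell.mean (fun e => e ∉ dirFreeEdges ⌈β ^ θ⌉₊) dirCorner (2 * ⌈β ^ θ⌉₊ + 3) (ϑ c)))
                (boxCentre ⌈β ^ θ⌉₊, 1, 2) *
              LatticeMaxwell.sCirc (LatticeMaxwell.glue (pin := fun e => e ∉ dirFreeEdges ⌈β ^ θ⌉₊) dirCorner (2 * ⌈β ^ θ⌉₊ + 3)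
                  (ϑ c) (LatticeMaxwell.mean (fun e => e ∉ dirFreeEdges ⌈β ^ θ⌉₊) dirCorner (2 * ⌈β ^ θ⌉₊ + 3) (ϑ c)))
                (boxCentre ⌈β ^ θ⌉₊ + Pi.single 0 (⌈β ^ A⌉₊ : ℤ), 1, 2)) *
            boxDirProjKernel ⌈β ^ θ⌉₊ (boxCentre ⌈β ^ θ⌉₊, 1, 2) (boxCentre ⌈β ^ θ⌉₊ + Pi.single 0 (⌈β ^ A⌉₊ : ℤ), 1, 2)|
        ≤ β ^ (-(θ / 2))

/-- **Interface N2-G (flat covariance form) — the sibling crux BOX_G in Dirichlet dress**, any `G` (`D = dimE ρ`): for the FLAT datum the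
cold-wall two-plaquette covariance is the Dirichlet Gaussian value with NO background,
`|β²·boxPlaqCov ρ β H ⌈β^A⌉ − (D/2)·C_D(p,q)²| ≤ β^{-θ/2}` for `β ≥ β₀`.  The `G`-typed form of `WeakCouplingRates.FlatCovExpansion`
(`SU(2)`: from `boxDirichletDominationAbs`).  A POSIT of the line (open), not a claim and not a literature fact. -/
def FlatCovExpansionG (A θ : ℝ) : Prop :=
  ∃ β₀ : ℝ, ∀ β : ℝ, β₀ ≤ β →
    |β ^ 2 * boxPlaqCov ρ β ⌈β ^ θ⌉₊ ⌈β ^ A⌉₊ -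
        (dimE ρ : ℝ) / 2 * boxDirProjKernel ⌈β ^ θ⌉₊ (boxCentre ⌈β ^ θ⌉₊, 1, 2) (boxCentre ⌈β ^ θ⌉₊ + Pi.single 0 (⌈β ^ A⌉₊ : ℤ), 1, 2) ^ 2|
      ≤ β ^ (-(θ / 2))

end Interfaces

end Summit.QuantumFields.YangMills.Theorems.ColdBoxAllGroups

end
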